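import Literature.AlgebraicGeometry.HodgeTheory.RibetTypeOnePowersHodgeClasses
import Literature.AlgebraicGeometry.HodgeTheory.SimpleAbelianSurfacePowersHodgeClasses
import Literature.AlgebraicGeometry.Motives.HodgeImaginaryQuadraticPureSignatureExtraEndomorphisms
import Literature.NumberTheory.DiophantineGeometry.AVIsogenyTateFreeHomProofs
import Literature.AlgebraicGeometry.ComplexMultiplication.EndAlgebraCenterDegreeDvdDim
import HarnessLib

/-!
# Multiplicities `(g, 0)` do not occur on a simple abelian variety (Shimura 1963, Prop. 14); Hodge classes on
the powers of a SIMPLE abelian THREEFOLD with quadratic `End⁰` are generated by divisor classes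
(Moonen–Zarhin 1999 (2.3) type IV(1,1), (2.5))

Family `hodge`, layer `Literature/AlgebraicGeometry/HodgeTheory`. Research context: cell `pub-hodge-ring2`
(HONEST FRAMING: research route conditional on HC_CM; not a corollary; Q11.4-sentence-2 already refuted in
dim ≥ 3), Literature lane, programme R12 (Shimura's exceptional cases in the kernel; towards the `p = 3` slice of
the named fact `TankeevRibet1983_hodgeClasses_divisorial_powers_simplePrimeDimension`). THEOREMS ONLY: no named
fact, no definition, no `sorry`.

THE PRINTED STATEMENTS. Moonen–Zarhin, Math. Ann. 315 (1999), (2.3): "`g = 3` … Type IV(1,1): `End⁰(X) = F` is an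
imaginary quadratic field; … `Hg(X) = U_F(V,ψ)`", p. 715: "`B(Xⁿ) = D(Xⁿ)` for all `n` … In particular the Hodge
conjecture is true for all such `Xⁿ`"; (2.5), proof: "if `g = 3` and `End⁰(X) = F` is imaginary quadratic,
`F` necessarily acts on the tangent space with multiplicities `(2,1)`. (An action with multiplicities `(3,0)` is
excluded; see [Shimura 1963], Proposition 14.)" Hulek–Laface 2019 Prop. 5.1, first exceptional case "`F` of type
IV, `∑ r_ν s_ν = 0`" with "under the assumption that `X` be simple … these cases never occur".

WHAT THIS FILE PROVES.
* §1 **`AbelianVariety.not_isSimple_of_eigenMultiplicity_eq_zero`** (Shimura Prop. 14, every dimension `g ≥ 2`):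
  if `φ ≫ φ = -d` (`d > 0`) and `φ^*` acts on `H^{1,0}(A)` with multiplicities `(g, 0)` or `(0, g)`
  (`eigenMultiplicity A φ (∓ i√d) = 0`), then `A` is NOT simple — the Hodge-theoretic theorem
  `ImaginaryQuadratic.exists_mem_endAlg_ne_zero_not_isUnit` (`Motives/HodgeImaginaryQuadraticPureSignature…`:
  `End_Hdg(H¹)` has a non-zero non-unit) carried to `End⁰(A)` by Riemann (`endAlgebraOpAlgEquivEndAlg`) and
  Mumford §19 Cor. 2 (`isUnit_or_eq_zero_of_isSimple`); `eigenMultiplicity_pos_of_isSimple` (both multiplicities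
  are positive on a simple `A`).
* §2 quadratic `End⁰`: `AbelianVariety.exists_mul_self_eq_neg_of_finrank_eq_two` (a quadratic `End⁰` FIELD that is
  not totally real contains `a` with `a² = -q`, `q > 0`), `AbelianVariety.exists_hom_comp_self_eq_neg` (from such an
  `a ∈ End⁰(A) = End(A) ⊗ ℚ`, an honest `φ : A ⟶ A` with `φ ≫ φ = -d`, `d ∈ ℕ_{>0}` — `End(A) ↪ End⁰(A)`,
  Mumford §19 Thm. 3).
* §3 **`AbelianVariety.isDivisorGenerated_powSucc_of_isSimple_threefold_of_finrank_eq_two`**: `A` simple,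
  `dim A = 3`, `dim_ℚ End⁰(A) = 2` ⟹ `B•(A^{N+1}) = D•(A^{N+1}) ⊗ ℂ` for all `N` — `End⁰(A)` is a quadratic field
  (Mumford §19 Cor. 2), not totally real (`[End⁰:ℚ] ∣ dim A` for totally real fields, `2 ∤ 3`), so imaginary
  quadratic; the multiplicities `(n', n'')` of `φ` add up to `3` (`eigenMultiplicity_add_eigenMultiplicity_neg_eq_dim`)
  and are both positive (§1), so one of them is `1` and the tree's Ribet-type theorem
  `AbelianVariety.isDivisorGenerated_powSucc_of_ribetTypeOne` (R9, `dim A ≥ 3`) applies; Hodge conjecture for all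
  powers and their isogeny classes.
TOWARDS `p = 3` OF TANKEEV–RIBET: with this file the cases `dim_ℚ End⁰(A) = 2` (here), `= 6` commutative
(`EndFieldFullDegree.isStablyNondegenerate_of_dim_le_five_of_ne_four`) of a simple threefold are kernel theorems;
`End⁰(A) = ℚ` (`Hg = Sp₆`, MZ99 (2.3) type I(1)), a totally real cubic field given as `dim_ℚ End⁰ = 3` (needs
commutativity of a `3`-dimensional division algebra) and the exclusion of a non-commutative `End⁰` of dimension `6`
are NOT in the tree.

## References
* [MoonenZarhin1999LowDim] B. Moonen, Yu. Zarhin, Math. Ann. 315 (1999) 711–733, §2 (2.3), (2.5) and p. 715.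
* [Shimura1963AnalyticFamilies] G. Shimura, Ann. of Math. 78 (1963) 149–192, §4 Prop. 14 (through MZ99 (2.5)).
* [HulekLaface2019PicardNumbersAV] K. Hulek, R. Laface, Ann. Sc. Norm. Super. Pisa (5) 19 (2019), Prop. 5.1.
* [Ribet1983] K. A. Ribet, Amer. J. Math. 105 (1983), Thm. 0 and Thm. 3.
* [MumfordAV1970] D. Mumford, *Abelian Varieties*, §19 Thm. 3, Cor. 2 of Thm. 1 (p. 174).
* [DeligneMilne1982Tannakian] P. Deligne, J. Milne, LNM 900, §6 Thm. 6.20 (Riemann).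
* [Shimura1998] G. Shimura, *Abelian Varieties with Complex Multiplication and Modular Functions*, §5.1 Prop. 5.
* [vanGeemen1994HodgeAV] B. van Geemen, LNM 1594 (1994), §2.4, Lemma 3.7.
-/

noncomputable section

open scoped TensorProduct
open CategoryTheory Module NumberField

namespace Literature.AlgebraicGeometry.HodgeTheory

open Literature.AlgebraicGeometry.Motives Literature.AlgebraicGeometry.ComplexMultiplication
open Literature.AlgebraicGeometry.Motives.HodgeStructure
open Literature.Barriers.HodgeConjecture (divisorClassesSpan)

variable {A : AbelianVariety ℂ}

/-! ### §1 Shimura's Proposition 14: multiplicities `(g, 0)` force `A` non-simple -/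

section PureSignature

/-- `(i√d)² = -d`. [folklore] -/
private theorem PureSignature.I_mul_sqrt_sq (d : ℕ) :
    (Complex.I * (Real.sqrt d : ℂ)) ^ 2 = -(((d : ℚ) : ℂ)) := by
  rw [mul_pow, Complex.I_sq, ← Complex.ofReal_pow, Real.sq_sqrt (Nat.cast_nonneg d), Complex.ofReal_natCast,
    Rat.cast_natCast]
  ring

/-- **Shimura 1963, Prop. 14 (Moonen–Zarhin (2.5)): an imaginary quadratic `ℚ(φ) ⊆ End⁰(A)`, `φ² = -d`, acting on
`H^{1,0}(A)` with multiplicities `(g, 0)` or `(0, g)`, `g = dim A ≥ 2`, forces `A` to be NON-simple.** Proof: on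
`H¹(A(ℂ); ℚ)` (rank `2g ≥ 4`) the signature of `φ^*` is pure, so `End_Hdg(H¹)` contains a non-zero non-unit `u`
(`ImaginaryQuadratic.exists_mem_endAlg_ne_zero_not_isUnit`); by Riemann `u = b^*` for some `b ∈ End⁰(A)`, `b ≠ 0`,
and on a simple `A` every such `b` is invertible (Mumford §19 Cor. 2), making `u` invertible.
[cite: MoonenZarhin1999LowDim, (2.5) (proof, p. 715)] [cite: Shimura1963AnalyticFamilies, §4 Prop. 14]
[cite: HulekLaface2019PicardNumbersAV, Prop. 5.1, first exceptional case and proof] [cite: MumfordAV1970, §19 Cor. 2 of Thm. 1 (p. 174)] -/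
theorem AbelianVariety.not_isSimple_of_eigenMultiplicity_eq_zero (A : AbelianVariety ℂ) (φ : A ⟶ A) {d : ℕ}
    (hd : 0 < d) (hφ : φ ≫ φ = -(d • 𝟙 A))
    (h0 : eigenMultiplicity A φ (Complex.I * (Real.sqrt d : ℂ)) = 0 ∨
      eigenMultiplicity A φ (-(Complex.I * (Real.sqrt d : ℂ))) = 0)
    (hdim : 2 ≤ A.dim) : ¬ A.IsSimple := by
  classical
  intro hA
  have hHD : exists_isReal_hodgeModel := exists_isReal_hodgeModel_holds
  have hI : hodgePQ_independent_of_hodgeModel := hodgePQ_independent_of_hodgeModel_holds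
  have hX : IsSmoothProjective A.dim A.X := AbelianVariety.isSmoothProjective_holds
  haveI : Module.Finite ℚ (bettiCohomology A.X 1) := finite_bettiCohomology_one A
  set H := BettiUniverse.hodge hHD (AbelianVariety.isSmoothProjective_holds (A := A)) 1 with hHdef
  set φQ : Module.End ℚ (bettiCohomology A.X 1) := (bettiCohomology.map φ.hom.hom.hom 1).hom with hφQ
  have hφE : φQ ∈ H.endAlg := by
    have h := unop_bettiRep_mem_endAlg hHD hI (AbelianVariety.endAlgebra.of A φ)
    rwa [bettiRep_of, MulOpposite.unop_op] at h
  have hφ2 : φQ * φQ = -((d : ℚ) • 1) := bettiMapHom_mul_self hφ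
  have hdQ : (0 : ℚ) < d := by exact_mod_cast hd
  have hV : 3 ≤ Module.finrank ℚ (bettiCohomology A.X 1) := by rw [finrank_bettiCohomology_one A]; omega
  set μ : ℂ := Complex.I * (Real.sqrt d : ℂ) with hμdef
  have hμ : μ ^ 2 = -(((d : ℚ) : ℂ)) := PureSignature.I_mul_sqrt_sq d
  -- pure signature: `V^{1,0} ∩ W_{-μ'} = 0` for `μ' = -μ` or `μ' = μ`
  have hbot : ∀ c : ℂ, eigenMultiplicity A φ c = 0 →
      H.piece 1 0 ⊓ Module.End.eigenspace (φQ.baseChange ℂ) c = ⊥ := fun c hc => by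
    rw [inf_comm, ← Submodule.finrank_eq_zero, hHdef, hφQ,
      finrank_eigenspace_inf_piece_oneZero_eq_eigenMultiplicity hHD hI φ c, hc]
  obtain ⟨u, huE, hu0, hnu⟩ : ∃ u ∈ H.endAlg, u ≠ 0 ∧ ¬ IsUnit u := by
    rcases h0 with h | h
    · have hμ' : (-μ) ^ 2 = -(((d : ℚ) : ℂ)) := by rw [neg_sq, hμ]
      have hA' : H.piece 1 0 ⊓ Module.End.eigenspace (φQ.baseChange ℂ) (-(-μ)) = ⊥ := by
        rw [neg_neg]; exact hbot μ h
      exact ImaginaryQuadratic.exists_mem_endAlg_ne_zero_not_isUnit H rfl (BettiUniverse.hodge_isEffective hHD hX 1)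
        hφE hdQ hφ2 hμ' hA' hV
    · exact ImaginaryQuadratic.exists_mem_endAlg_ne_zero_not_isUnit H rfl (BettiUniverse.hodge_isEffective hHD hX 1)
        hφE hdQ hφ2 hμ (hbot (-μ) h) hV
  -- transport to `End⁰(A)` by Riemann
  set e := endAlgebraOpAlgEquivEndAlg (B := A) hHD hI with hedef
  set b : A.endAlgebra := MulOpposite.unop (e.symm ⟨u, huE⟩) with hbdef
  have hbu : MulOpposite.unop (bettiRep A b) = u := by
    have h := coe_endAlgebraOpAlgEquivEndAlg_apply hHD hI (MulOpposite.op b)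
    rw [MulOpposite.unop_op] at h
    rw [← h, hbdef, MulOpposite.op_unop, ← hedef, AlgEquiv.apply_symm_apply]
  have hb0 : b ≠ 0 := fun h => hu0 (by rw [← hbu, h, map_zero, MulOpposite.unop_zero])
  rcases isUnit_or_eq_zero_of_isSimple hA b with hbU | hb
  · obtain ⟨c, hcb⟩ := hbU.exists_left_inv
    obtain ⟨c', hbc'⟩ := hbU.exists_right_inv
    have h1 : u * MulOpposite.unop (bettiRep A c) = 1 := by
      rw [← hbu, ← MulOpposite.unop_mul, ← map_mul, hcb, map_one, MulOpposite.unop_one]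
    have h2 : MulOpposite.unop (bettiRep A c') * u = 1 := by
      rw [← hbu, ← MulOpposite.unop_mul, ← map_mul, hbc', map_one, MulOpposite.unop_one]
    have hcc : MulOpposite.unop (bettiRep A c') = MulOpposite.unop (bettiRep A c) := by
      calc MulOpposite.unop (bettiRep A c')
          = MulOpposite.unop (bettiRep A c') * (u * MulOpposite.unop (bettiRep A c)) := by rw [h1, mul_one]
        _ = MulOpposite.unop (bettiRep A c) := by rw [← mul_assoc, h2, one_mul]
    rw [hcc] at h2
    exact hnu ⟨⟨u, MulOpposite.unop (bettiRep A c), h1, h2⟩, rfl⟩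
  · exact hb0 hb

/-- **Both multiplicities are positive on a simple abelian variety of dimension `≥ 2`** carrying `φ` with
`φ ≫ φ = -d`, `d > 0`. [cite: MoonenZarhin1999LowDim, (2.5) (proof, p. 715)] [cite: Shimura1963AnalyticFamilies, §4 Prop. 14] -/
theorem AbelianVariety.eigenMultiplicity_pos_of_isSimple (A : AbelianVariety ℂ) (hA : A.IsSimple) (φ : A ⟶ A)
    {d : ℕ} (hd : 0 < d) (hφ : φ ≫ φ = -(d • 𝟙 A)) (hdim : 2 ≤ A.dim) :
    0 < eigenMultiplicity A φ (Complex.I * (Real.sqrt d : ℂ)) ∧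
      0 < eigenMultiplicity A φ (-(Complex.I * (Real.sqrt d : ℂ))) := by
  have h := AbelianVariety.not_isSimple_of_eigenMultiplicity_eq_zero A φ hd hφ
  constructor
  · exact Nat.pos_of_ne_zero fun h0 => h (Or.inl h0) hdim hA
  · exact Nat.pos_of_ne_zero fun h0 => h (Or.inr h0) hdim hA

end PureSignature

/-! ### §2 Quadratic `End⁰`: a square root of a negative rational, and an honest endomorphism -/

section Quadratic

variable {D : Type*} [Ring D] [Algebra ℚ D]

/-- In a `ℚ`-algebra of dimension `2` there is `y ∉ ℚ·1` with `y² ∈ ℚ·1` and `D = ℚ·1 + ℚ·y` (complete the square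
of any non-scalar). [folklore] -/
private theorem Quadratic.exists_sq_mem_of_finrank_eq_two [Nontrivial D] (h2 : Module.finrank ℚ D = 2) :
    ∃ y : D, ∃ r : ℚ, y ∉ (⊥ : Subalgebra ℚ D) ∧ y * y = r • 1 ∧ ∀ z : D, ∃ a b : ℚ, z = a • 1 + b • y := by
  classical
  haveI : Module.Finite ℚ D := Module.finite_of_finrank_eq_succ h2
  -- a non-scalar `x`
  have hbot : (⊥ : Subalgebra ℚ D) ≠ ⊤ := fun h => by
    have h1 := Subalgebra.bot_eq_top_iff_finrank_eq_one.1 h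
    omega
  obtain ⟨x, -, hx⟩ := SetLike.exists_of_lt (lt_top_iff_ne_top.2 hbot)
  -- `1, x` is a basis
  have hli : LinearIndependent ℚ ![(1 : D), x] := by
    rw [LinearIndependent.pair_iff]
    intro s t hst
    by_cases ht : t = 0
    · subst ht
      rw [zero_smul, add_zero, smul_eq_zero] at hst
      exact ⟨hst.resolve_right one_ne_zero, rfl⟩
    · exfalso
      apply hx
      rw [Algebra.mem_bot]
      refine ⟨-(s / t), ?_⟩
      rw [Algebra.algebraMap_eq_smul_one]
      have h : t • x = -(s • 1) := eq_neg_of_add_eq_zero_right hst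
      calc (-(s / t)) • (1 : D) = t⁻¹ • (-(s • 1)) := by rw [smul_neg, smul_smul, neg_smul, div_eq_inv_mul]
        _ = x := by rw [← h, smul_smul, inv_mul_cancel₀ ht, one_smul]
  have hspan : ∀ z : D, ∃ a b : ℚ, z = a • 1 + b • x := by
    intro z
    have htop : Submodule.span ℚ (Set.range ![(1 : D), x]) = ⊤ :=
      Submodule.eq_top_of_finrank_eq (by rw [finrank_span_eq_card hli, Fintype.card_fin, h2])
    have hz : z ∈ Submodule.span ℚ (Set.range ![(1 : D), x]) := by rw [htop]; exact Submodule.mem_top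
    rw [Submodule.mem_span_range_iff_exists_fun] at hz
    obtain ⟨c, hc⟩ := hz
    refine ⟨c 0, c 1, ?_⟩
    rw [← hc, Fin.sum_univ_two]
    rfl
  -- complete the square
  obtain ⟨c₀, c₁, hxx⟩ := hspan (x * x)
  refine ⟨x - (c₁ / 2) • 1, c₀ + c₁ ^ 2 / 4, ?_, ?_, ?_⟩
  · intro hmem
    apply hx
    have h : x = (x - (c₁ / 2) • 1) + (c₁ / 2) • 1 := by rw [sub_add_cancel]
    rw [h]
    exact Subalgebra.add_mem _ hmem (Subalgebra.smul_mem _ (Subalgebra.one_mem _) _)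
  · rw [sub_mul, mul_sub, mul_sub, hxx]
    simp only [smul_one_mul, mul_smul_one, smul_smul]
    module
  · intro z
    obtain ⟨a, b, rfl⟩ := hspan z
    exact ⟨a + b * (c₁ / 2), b, by module⟩

/-- **A quadratic `End⁰(A)` field that is NOT totally real contains `a` with `a² = -q`, `q > 0`** (it is
`ℚ + ℚy` with `y² = r ∈ ℚ`; `r ≥ 0` would make every complex embedding real). [cite: Shimura1998, §5.1 Proposition 5 (p. 36)]
[cite: MoonenZarhin1999LowDim, §2 (2.3) type IV(1,1)] -/
theorem AbelianVariety.exists_mul_self_eq_neg_of_finrank_eq_two (h0 : 0 < A.dim)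
    (h2 : Module.finrank ℚ A.endAlgebra = 2) (hF : IsField A.endAlgebra) (hnR : ¬ IsTotallyReal (EndField A hF)) :
    ∃ (a : A.endAlgebra) (q : ℚ), 0 < q ∧ a * a = -(q • 1) := by
  classical
  haveI : Nontrivial A.endAlgebra := nontrivial_endAlgebra_of_dim_pos h0
  obtain ⟨y, r, -, hyy, hspan⟩ := Quadratic.exists_sq_mem_of_finrank_eq_two (D := A.endAlgebra) h2
  rcases lt_or_ge r 0 with hr | hr
  · exact ⟨y, -r, neg_pos.2 hr, by rw [hyy]; module⟩
  · exfalso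
    apply hnR
    set e := EndField.toEndAlgebra hF with hedef
    have hreal : ∀ σE : EndField A hF →+* ℂ, ComplexEmbedding.IsReal σE := fun σE => by
      set σ : A.endAlgebra →+* ℂ := σE.comp e.symm.toRingHom with hσdef
      have hσE : ∀ k : EndField A hF, σE k = σ (e k) := fun k => by
        rw [hσdef, RingHom.comp_apply]
        exact congrArg σE (e.symm_apply_apply k).symm
      have hσq : ∀ q : ℚ, σ (q • (1 : A.endAlgebra)) = (q : ℂ) := fun q => by
        rw [← Algebra.algebraMap_eq_smul_one]
        exact eq_ratCast (σ.comp (algebraMap ℚ A.endAlgebra)) q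
      have hσy2 : σ y * σ y = (r : ℂ) := by rw [← map_mul, hyy, hσq]
      have hσy : starRingEnd ℂ (σ y) = σ y := by
        have hr' : (0 : ℝ) ≤ (r : ℝ) := by exact_mod_cast hr
        have hw : σ y * σ y = (Real.sqrt r : ℂ) * (Real.sqrt r : ℂ) := by
          rw [hσy2, ← Complex.ofReal_mul, Real.mul_self_sqrt hr', Complex.ofReal_ratCast]
        rcases mul_self_eq_mul_self_iff.1 hw with h | h
        · rw [h, Complex.conj_ofReal]
        · rw [h, map_neg, Complex.conj_ofReal]
      have hσreal : ∀ z : A.endAlgebra, starRingEnd ℂ (σ z) = σ z := fun z => by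
        obtain ⟨a, b, rfl⟩ := hspan z
        rw [map_add, ← smul_one_mul b y, map_mul, hσq, hσq, map_add, map_mul, map_ratCast, map_ratCast, hσy]
      exact ComplexEmbedding.isReal_iff.2 (RingHom.ext fun k => by rw [ComplexEmbedding.conjugate_coe_eq, hσE, hσreal])
    exact ⟨fun w => by
      rw [← InfinitePlace.mk_embedding w]
      exact InfinitePlace.isReal_mk_iff.2 (hreal w.embedding)⟩

/-- **From `a ∈ End⁰(A) = End(A) ⊗ ℚ` with `a² = -q`, `q > 0`, an honest `φ : A ⟶ A` with `φ ≫ φ = -d`,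
`d ∈ ℕ`, `d > 0`**: `a = M⁻¹ ⊗ F`, `φ := den(q) · F`, `d = den(q) · M² · num(q)` (`End(A) ↪ End⁰(A)`, Mumford §19
Thm. 3: the tree's `endAlgebra.of_injective_of_charZero`). [cite: MumfordAV1970, §19 Thm. 3 and Cor. 2] -/
theorem AbelianVariety.exists_hom_comp_self_eq_neg (A : AbelianVariety ℂ) {a : A.endAlgebra} {q : ℚ}
    (hq : 0 < q) (ha : a * a = -(q • 1)) : ∃ (φ : A ⟶ A) (d : ℕ), 0 < d ∧ φ ≫ φ = -(d • 𝟙 A) := by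
  obtain ⟨M, F, hM, haF⟩ := AbelianVariety.endAlgebra.exists_eq_algebraMap_mul_of a
  have hMQ : (M : ℚ) ≠ 0 := Nat.cast_ne_zero.2 hM
  have hF : AbelianVariety.endAlgebra.of A F = (M : ℚ) • a := by
    rw [haF, Algebra.algebraMap_eq_smul_one, smul_mul_assoc, one_mul, smul_smul, mul_inv_cancel₀ hMQ, one_smul]
  -- `G := den(q) • F`, `G² = -(den(q) · M² · num(q))`
  set G : End A := q.den • F with hGdef
  have hnum : 0 < q.num := Rat.num_pos.2 hq
  set d : ℕ := q.den * M ^ 2 * q.num.toNat with hddef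
  have hdQ : (d : ℚ) = (q.den : ℚ) * (q.den : ℚ) * ((M : ℚ) * (M : ℚ)) * q := by
    have hn : ((q.num.toNat : ℕ) : ℚ) = (q.num : ℚ) := by exact_mod_cast Int.toNat_of_nonneg hnum.le
    rw [hddef, Nat.cast_mul, Nat.cast_mul, Nat.cast_pow, hn, ← Rat.mul_den_eq_num q]
    ring
  have hd : 0 < d := by
    rw [hddef]
    exact Nat.mul_pos (Nat.mul_pos q.den_pos (pow_pos (Nat.pos_of_ne_zero hM) 2)) (by omega)
  have hofG : AbelianVariety.endAlgebra.of A G = ((q.den : ℚ) * (M : ℚ)) • a := by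
    rw [hGdef, map_nsmul, hF, ← Nat.cast_smul_eq_nsmul ℚ, smul_smul]
  have hG2 : AbelianVariety.endAlgebra.of A (G * G) = AbelianVariety.endAlgebra.of A (-(d • 1)) := by
    rw [map_mul, hofG, smul_mul_smul_comm, ha, smul_neg, smul_smul, map_neg, map_nsmul, map_one,
      ← Nat.cast_smul_eq_nsmul ℚ d (1 : A.endAlgebra), hdQ]
    congr 2
    ring
  have hGG : G * G = -(d • 1) := AbelianVariety.endAlgebra.of_injective_of_charZero (A := A) hG2
  refine ⟨End.asHom G, d, hd, ?_⟩
  change G * G = -(d • (1 : End A))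
  exact hGG

end Quadratic

/-! ### §3 Simple abelian threefolds with quadratic `End⁰` (Moonen–Zarhin type IV(1,1), `g = 3`) -/

section Threefold

/-- **Moonen–Zarhin 1999 (2.3) type IV(1,1) joined with (2.5): `B•(A^{N+1}) = D•(A^{N+1}) ⊗ ℂ` for every SIMPLE
complex abelian THREEFOLD with `dim_ℚ End⁰(A) = 2`.** `End⁰(A)` is a quadratic field (Mumford §19 Cor. 2), not
totally real (`[End⁰:ℚ] ∣ dim A` for totally real fields; `2 ∤ 3`), so `End⁰(A) = ℚ(φ)`, `φ ≫ φ = -d`; the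
multiplicities of `φ` on `H^{1,0}` are positive (Shimura Prop. 14, §1) and add up to `3`, so they are `(2,1)` and
Ribet's theorem (the tree's `AbelianVariety.isDivisorGenerated_powSucc_of_ribetTypeOne`) gives `B = D` on all
powers. [cite: MoonenZarhin1999LowDim, §2 (2.3) type IV(1,1), (2.5) and p. 715] [cite: Ribet1983, Thm. 0 and Thm. 3]
[cite: Shimura1963AnalyticFamilies, §4 Prop. 14] -/
theorem AbelianVariety.isDivisorGenerated_powSucc_of_isSimple_threefold_of_finrank_eq_two (A : AbelianVariety ℂ)
    (hA : A.IsSimple) (hdim : A.dim = 3) (h2 : Module.finrank ℚ A.endAlgebra = 2) (N : ℕ) :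
    IsDivisorGenerated (A.powSucc N) := by
  classical
  have h0 : 0 < A.dim := by omega
  have hF : IsField A.endAlgebra := AbelianVariety.isField_endAlgebra_of_isSimple_of_finrank_eq_two hA h0 h2
  have hnR : ¬ IsTotallyReal (EndField A hF) := fun hR => by
    have h := finrank_endAlgebra_dvd_dim_of_isField_of_isTotallyReal hF h0 hR
    rw [h2, hdim] at h
    omega
  obtain ⟨a, q, hq, ha⟩ := AbelianVariety.exists_mul_self_eq_neg_of_finrank_eq_two h0 h2 hF hnR
  obtain ⟨φ, d, hd, hφ⟩ := AbelianVariety.exists_hom_comp_self_eq_neg A hq ha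
  have hsum := eigenMultiplicity_add_eigenMultiplicity_neg_eq_dim A φ hd hφ
  have hpos := AbelianVariety.eigenMultiplicity_pos_of_isSimple A hA φ hd hφ (by omega)
  have h1 : eigenMultiplicity A φ (Complex.I * (Real.sqrt d : ℂ)) = 1 ∨
      eigenMultiplicity A φ (-(Complex.I * (Real.sqrt d : ℂ))) = 1 := by omega
  exact AbelianVariety.isDivisorGenerated_powSucc_of_ribetTypeOne A φ hd hφ h2 h1 (by omega) N

/-- `IsStablyNondegenerate A` for a simple threefold with quadratic `End⁰`. [cite: MoonenZarhin1999LowDim, §2 condition (D) and (2.3)] -/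
theorem AbelianVariety.isStablyNondegenerate_of_isSimple_threefold_of_finrank_eq_two (A : AbelianVariety ℂ)
    (hA : A.IsSimple) (hdim : A.dim = 3) (h2 : Module.finrank ℚ A.endAlgebra = 2) : IsStablyNondegenerate A :=
  fun N => AbelianVariety.isDivisorGenerated_powSucc_of_isSimple_threefold_of_finrank_eq_two A hA hdim h2 N

/-- `A` itself: `B•(A) = D•(A) ⊗ ℂ`. [cite: MoonenZarhin1999LowDim, §2 (2.3)] -/
theorem AbelianVariety.isDivisorGenerated_of_isSimple_threefold_of_finrank_eq_two (A : AbelianVariety ℂ)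
    (hA : A.IsSimple) (hdim : A.dim = 3) (h2 : Module.finrank ℚ A.endAlgebra = 2) : IsDivisorGenerated A :=
  (AbelianVariety.isStablyNondegenerate_of_isSimple_threefold_of_finrank_eq_two A hA hdim h2).isDivisorGenerated

/-- **The Hodge conjecture for every power of a simple complex abelian threefold with quadratic `End⁰` —
UNCONDITIONAL** (MZ99 p. 715: "In particular the Hodge conjecture is true for all such `Xⁿ`").
[cite: MoonenZarhin1999LowDim, §2 (2.3) and p. 715] [cite: vanGeemen1994HodgeAV, §2.4] -/
theorem hodgeConjectureFor_powSucc_of_isSimple_threefold_of_finrank_eq_two (A : AbelianVariety ℂ) (hA : A.IsSimple)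
    (hdim : A.dim = 3) (h2 : Module.finrank ℚ A.endAlgebra = 2) (N : ℕ) :
    HodgeConjectureFor (A.powSucc N).dim (A.powSucc N).X :=
  hodgeConjectureFor_of_isDivisorGenerated _
    (AbelianVariety.isDivisorGenerated_powSucc_of_isSimple_threefold_of_finrank_eq_two A hA hdim h2 N)

/-- The Hodge conjecture for every complex abelian variety isogenous to a power of such a threefold (van Geemen
Lemma 3.7). [cite: vanGeemen1994HodgeAV, Lemma 3.7] [cite: MoonenZarhin1999LowDim, §2 (2.3)] -/
theorem hodgeConjectureFor_of_isIsogenous_powSucc_of_isSimple_threefold_of_finrank_eq_two {A B : AbelianVariety ℂ}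
    (hA : A.IsSimple) (hdim : A.dim = 3) (h2 : Module.finrank ℚ A.endAlgebra = 2) {N : ℕ}
    (hB : B.IsIsogenous (A.powSucc N)) : HodgeConjectureFor B.dim B.X :=
  HodgeConjectureFor.of_isIsogenous hB
    (hodgeConjectureFor_powSucc_of_isSimple_threefold_of_finrank_eq_two A hA hdim h2 N)

/-- In the fact's shape: rational `(m,m)`-classes on `X^{N+1}` are divisorial, for `X` a simple threefold with
`dim_ℚ End⁰(X) = 2` (a case of the `p = 3` slice of `TankeevRibet1983_hodgeClasses_divisorial_powers_simplePrimeDimension`).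
[cite: MoonenZarhin1999LowDim, §2 Thm. (2.7) and (2.3)] [cite: Ribet1983, Thm. 3] -/
theorem tankeevRibet1983_of_dim_three_of_finrank_eq_two (X : AbelianVariety ℂ) (hX : X.dim = 3) (hs : X.IsSimple)
    (h2 : Module.finrank ℚ X.endAlgebra = 2) (N m : ℕ) (c : complexBetti (X.powSucc N).X (2 * m))
    (hc : IsRationalClass c) (hmm : IsOfHodgeType (X.powSucc N).dim (X.powSucc N).X (2 * m) m m c) :
    c ∈ divisorClassesSpan (X.powSucc N).X (X.powSucc N).dim m :=
  AbelianVariety.isDivisorGenerated_powSucc_of_isSimple_threefold_of_finrank_eq_two X hs hX h2 N m c hc hmm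

end Threefold

end Literature.AlgebraicGeometry.HodgeTheory

end
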